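import Mathlib.LinearAlgebra.Matrix.Circulant
import Literature.Combinatorics.Designs.DifferenceSetMultiplier
import Literature.InformationTheory.QuantumCodes.CSS
import HarnessLib

/-!
# MacKay–Mitchison–McFadden difference-set codes (Constructions U and N): dual-containing — proved

Topic `Literature/InformationTheory/QuantumCodes`. Source followed: D. J. C. MacKay, G. Mitchison,
P. L. McFadden, *Sparse-graph codes for quantum error correction*, IEEE Trans. Inform. Theory **50** (2004)
2315–2330 = arXiv:quant-ph/0304161 [MacKayMitchisonMcFadden2004], §4.6 (held TeX chunk p0014), read on
the page (Construction B = `BicycleCodes.lean`):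

> **Construction U** (L1–47): «Unicycle codes are made with the help of a perfect difference set over the
> additive group of size `M̃ = 73, 273, 1057`, or `4161`. For example, a perfect difference set for the
> group of size `M̃ = 73` is `{2,8,15,19,20,34,42,44,72}`. … By making a cyclic matrix `C` from a perfect
> difference set, we obtain a parity check matrix that defines a code with blocklength `N = M̃` … The
> perfect-difference-set property implies that all pairs of rows of `C` have an overlap of `1`. To create
> a dual-containing code, we need to make these overlaps even. We do this by extending the parity check
> matrix, adding one extra column, all ones. Since all pairs of rows of this additional column have an
> overlap of `1`, all rows of the new parity check matrix have overlap `2`. Thus we have defined a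
> dual-containing `(N+1, K+1)` code with parity check matrix `H` whose row weight is `k+1` (for example,
> `10`, for `M̃ = 73`) and whose column weights are all `k` except for one column with enormous weight
> `M̃`. … Another disappointing property is that the code has codewords of weight equal to the
> row-weight.»
>
> **Construction N** (L50–76): «We choose a number of rows `M` and an integer `v` such as `v = 4` and
> create `v` cyclic matrices from `v` cyclic difference sets over `{0,1,2,…,(M−1)}`, with the special
> property that every difference (modulo `M`) occurs zero times or twice … We turn each set into a square
> cyclic matrix and put the matrices alongside each other to make the parity check matrix `H`. Since
> every difference occurs an even number of times, the overlap between any pair of rows is even.»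
> **Construction M** (L78–90) «is a special case of construction N». Caveat (L92–101): «a code built from
> `v` square cyclic matrices each of weight `j` inevitably has many codewords of weight `2j`: for any
> pair of square cyclic matrices associated with vectors `f` and `g` (both of weight `j`), the vector
> `(g, f)` is a weight-`2j` codeword».

Formalisation (PROVED, no named facts), over any finite additive commutative group `G` as the cyclic
index set (`ℤ_{M̃}` / `ℤ_M` in the paper) and the tree's `IsDifferenceSet D λ` of
`Combinatorics/Designs/DifferenceSetMultiplier.lean` (perfect difference set = `λ = 1`):

* `cyclicOf D` — «the cyclic matrix `C` made from `D`»: row `g` is the indicator of the translate `D + g`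
  (`= (circulant 1_D)ᵀ`, `cyclicOf_eq_transpose_circulant`); its Gram entries count common points,
  `cyclicOf_mul_transpose_apply : (C Cᵀ)_{g,h} = #{a ∈ D | (g − h) + a ∈ D}`, so `= λ` off the diagonal
  for a `(v,k,λ)` difference set («all pairs of rows of `C` have an overlap of `1`») and `= k` on it;
* **Construction U**: `unicycleMatrix D = [C | 𝟙]` (one all-ones column adjoined), Gram entries `λ + 1`
  off / `k + 1` on the diagonal (`unicycleMatrix_mul_transpose_apply_of_ne / _self`: «all rows of the new
  parity check matrix have overlap 2», «row weight is `k+1`»), hence **`MacKayMitchisonMcFadden2004_constructionU`**: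
  for a perfect difference set of ODD size `k` (as for `M̃ = q² + q + 1`, `k = q + 1`, `q = 8, 16, 32, 64`),
  `H Hᵀ = 0` in characteristic two; the CSS code `unicycleCode D` (`H_X = H_Z = H`, the tree's `CSSCode`);
  `unicycle_row_mem_ker` («the code has codewords of weight equal to the row-weight»: every row of `H` is in
  `ker H`); the printed example `isDifferenceSet_pds73` (`{2,8,15,19,20,34,42,44,72} ⊂ ℤ₇₃` is a perfect
  difference set, kernel `decide`) and `unicycleCode73`;
* **Construction N**: `multiCyclicMatrix D = [C_{D₁} | ⋯ | C_{D_v}]` for a family `D : ι → Finset G`, Gram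
  entries `Σ_l #{a ∈ D_l | (g − h) + a ∈ D_l}` = the number of times the difference `g − h` occurs, hence
  **`MacKayMitchisonMcFadden2004_constructionN`**: if every nonzero difference occurs an even number of
  times and the total row weight `Σ_l |D_l|` is even, `H Hᵀ = 0` in characteristic two; CSS code
  `multiCyclicCode`; the caveat `multiCyclicMatrix_mulVec_pairWord` — for blocks `l₁ ≠ l₂` the word with
  `g`'s column on block `l₁` and `f`'s column on block `l₂` is in `ker H` (cyclic matrices commute).

Not formalised: the numbers of independent rows `M` / dimensions `K` of the paper's table (fig. dsc(b) is
a figure, not in the held text), anything probabilistic, decoding.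
-/

namespace Literature.InformationTheory.QuantumCodes

namespace DifferenceSetCSS

open Matrix Finset Literature.Combinatorics.Designs.DifferenceSets

variable {G : Type*} [AddCommGroup G] [DecidableEq G] {R : Type*}

/-! ### The cyclic matrix of a subset and its Gram entries -/

/-- «By making a cyclic matrix `C` from a [difference] set»: row `g` of `cyclicOf D` is the indicator of
the translate `D + g`, i.e. `C_{g,x} = [x − g ∈ D]`.
[cite: MacKayMitchisonMcFadden2004, §4.6 Construction U (arXiv:quant-ph/0304161 chunk p0014 L7–9)] -/
def cyclicOf [Zero R] [One R] (D : Finset G) : Matrix G G R :=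
  of fun g x => if x - g ∈ D then 1 else 0

/-- Entries of `cyclicOf`. [cite: MacKayMitchisonMcFadden2004, §4.6 Construction U (arXiv:quant-ph/0304161 chunk p0014 L7–9)] -/
theorem cyclicOf_apply [Zero R] [One R] (D : Finset G) (g x : G) :
    cyclicOf (R := R) D g x = if x - g ∈ D then 1 else 0 := rfl

/-- `cyclicOf D` is Mathlib's circulant of the indicator of `−D`: `cyclicOf D = circulant (t ↦ [−t ∈ D])`.
[cite: MacKayMitchisonMcFadden2004, §4.6 Construction U (arXiv:quant-ph/0304161 chunk p0014 L7–9)] -/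
theorem cyclicOf_eq_circulant [Zero R] [One R] (D : Finset G) :
    cyclicOf (R := R) D = circulant fun t => if -t ∈ D then 1 else 0 := by
  ext g x
  rw [cyclicOf_apply, circulant_apply, neg_sub]

variable [Fintype G]

/-- Common points of two translates: `#{x | x − g ∈ D ∧ x − h ∈ D} = #{a ∈ D | (g − h) + a ∈ D}` (the
number of representations of `g − h` as a difference of two elements of `D`). [folklore] -/
private theorem card_common_points (D : Finset G) (g h : G) :
    (univ.filter fun x : G => x - g ∈ D ∧ x - h ∈ D).card = (D.filter fun a => (g - h) + a ∈ D).card := by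
  refine Finset.card_bij' (fun x _ => x - g) (fun a _ => a + g) ?_ ?_ ?_ ?_
  · intro x hx
    simp only [mem_filter, mem_univ, true_and] at hx ⊢
    refine ⟨hx.1, ?_⟩
    have : g - h + (x - g) = x - h := by abel
    rw [this]; exact hx.2
  · intro a ha
    simp only [mem_filter, mem_univ, true_and] at ha ⊢
    refine ⟨by rw [add_sub_cancel_right]; exact ha.1, ?_⟩
    have : a + g - h = g - h + a := by abel
    rw [this]; exact ha.2
  · intro x _; exact sub_add_cancel x g
  · intro a _; exact add_sub_cancel_right a g

/-- The support of a row of `C` is a translate of `D`: `#{x | x − g ∈ D} = |D|`. [folklore] -/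
private theorem card_filter_sub_mem (D : Finset G) (g : G) :
    (univ.filter fun x : G => x - g ∈ D).card = D.card := by
  refine Finset.card_bij' (fun x _ => x - g) (fun a _ => a + g) ?_ ?_ ?_ ?_
  · intro x hx
    simpa only [mem_filter, mem_univ, true_and] using hx
  · intro a ha
    simpa only [mem_filter, mem_univ, true_and, add_sub_cancel_right] using ha
  · intro x _; exact sub_add_cancel x g
  · intro a _; exact add_sub_cancel_right a g

/-- **Gram entries of the cyclic matrix count overlaps:** `(C Cᵀ)_{g,h} = #{a ∈ D | (g − h) + a ∈ D}`,
the number of common points of the rows `D + g` and `D + h`.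
[cite: MacKayMitchisonMcFadden2004, §4.6 Construction U (arXiv:quant-ph/0304161 chunk p0014 L19–20)] -/
theorem cyclicOf_mul_transpose_apply [Semiring R] (D : Finset G) (g h : G) :
    (cyclicOf D * (cyclicOf D)ᵀ : Matrix G G R) g h = ((D.filter fun a => (g - h) + a ∈ D).card : R) := by
  rw [← card_common_points D g h, mul_apply]
  simp only [transpose_apply, cyclicOf_apply]
  rw [← Finset.sum_boole]
  refine Finset.sum_congr rfl fun x _ => ?_
  by_cases h1 : x - g ∈ D <;> by_cases h2 : x - h ∈ D <;> simp [h1, h2]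

/-- «The perfect-difference-set property implies that all pairs of rows of `C` have an overlap of `1`»;
generally `λ` for a `(v,k,λ)` difference set.
[cite: MacKayMitchisonMcFadden2004, §4.6 Construction U (arXiv:quant-ph/0304161 chunk p0014 L19–20)] -/
theorem cyclicOf_mul_transpose_apply_of_ne [Semiring R] {D : Finset G} {lam : ℕ}
    (hD : IsDifferenceSet D lam) {g h : G} (hgh : g ≠ h) :
    (cyclicOf D * (cyclicOf D)ᵀ : Matrix G G R) g h = lam := by
  rw [cyclicOf_mul_transpose_apply, hD (g - h) (sub_ne_zero.2 hgh)]

/-- Diagonal Gram entries: a row of `C` has weight `k = |D|`.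
[cite: MacKayMitchisonMcFadden2004, §4.6 Construction U (arXiv:quant-ph/0304161 chunk p0014 L28–30)] -/
theorem cyclicOf_mul_transpose_apply_self [Semiring R] (D : Finset G) (g : G) :
    (cyclicOf D * (cyclicOf D)ᵀ : Matrix G G R) g g = D.card := by
  rw [cyclicOf_mul_transpose_apply, sub_self, Finset.filter_true_of_mem fun a ha => by rwa [zero_add]]

/-- In characteristic two an even count vanishes. [folklore] -/
private theorem natCast_eq_zero_of_even [Semiring R] (h2 : (2 : R) = 0) {n : ℕ} (hn : Even n) :
    (n : R) = 0 := by
  obtain ⟨m, rfl⟩ := hn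
  rw [Nat.cast_add, ← two_mul, h2, zero_mul]

/-! ### Construction U (unicycle): `H = [C | 𝟙]` -/

omit [Fintype G] in
/-- **The unicycle matrix** `H = [C | 𝟙]`: the cyclic matrix of the (perfect) difference set `D` with
«one extra column, all ones» adjoined (column index `Unit`).
[cite: MacKayMitchisonMcFadden2004, §4.6 Construction U (arXiv:quant-ph/0304161 chunk p0014 L21–24)] -/
def unicycleMatrix [Zero R] [One R] (D : Finset G) : Matrix G (G ⊕ Unit) R :=
  fromCols (cyclicOf D) (of fun _ _ => 1)

omit [Fintype G] in
/-- Unfolding of `unicycleMatrix`. [cite: MacKayMitchisonMcFadden2004, §4.6 Construction U (arXiv:quant-ph/0304161 chunk p0014 L21–24)] -/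
theorem unicycleMatrix_def [Zero R] [One R] (D : Finset G) :
    unicycleMatrix (R := R) D = fromCols (cyclicOf D) (of fun _ _ => 1) := rfl

omit [Fintype G] in
/-- Entries of the unicycle matrix on the cyclic block. [cite: MacKayMitchisonMcFadden2004, §4.6 Construction U (arXiv:quant-ph/0304161 chunk p0014 L21–24)] -/
@[simp] theorem unicycleMatrix_apply_inl [Zero R] [One R] (D : Finset G) (g x : G) :
    unicycleMatrix (R := R) D g (Sum.inl x) = if x - g ∈ D then 1 else 0 := rfl

omit [Fintype G] in
/-- The adjoined column is all ones. [cite: MacKayMitchisonMcFadden2004, §4.6 Construction U (arXiv:quant-ph/0304161 chunk p0014 L23–24)] -/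
@[simp] theorem unicycleMatrix_apply_inr [Zero R] [One R] (D : Finset G) (g : G) (u : Unit) :
    unicycleMatrix (R := R) D g (Sum.inr u) = 1 := rfl

/-- **Gram entries of `H = [C | 𝟙]`:** the overlap of rows `g, h` is that of `C` plus one («Since all pairs
of rows of this additional column have an overlap of `1` …»).
[cite: MacKayMitchisonMcFadden2004, §4.6 Construction U (arXiv:quant-ph/0304161 chunk p0014 L24–26)] -/
theorem unicycleMatrix_mul_transpose_apply [Semiring R] (D : Finset G) (g h : G) :
    (unicycleMatrix D * (unicycleMatrix D)ᵀ : Matrix G G R) g h =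
      ((D.filter fun a => (g - h) + a ∈ D).card : R) + 1 := by
  rw [unicycleMatrix_def, transpose_fromCols, fromCols_mul_fromRows, Matrix.add_apply,
    cyclicOf_mul_transpose_apply]
  congr 1
  simp [mul_apply]

/-- «… all rows of the new parity check matrix have overlap `2`» (for a perfect difference set; `λ + 1` in
general). [cite: MacKayMitchisonMcFadden2004, §4.6 Construction U (arXiv:quant-ph/0304161 chunk p0014 L24–26)] -/
theorem unicycleMatrix_mul_transpose_apply_of_ne [Semiring R] {D : Finset G} {lam : ℕ}
    (hD : IsDifferenceSet D lam) {g h : G} (hgh : g ≠ h) :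
    (unicycleMatrix D * (unicycleMatrix D)ᵀ : Matrix G G R) g h = lam + 1 := by
  rw [unicycleMatrix_mul_transpose_apply, hD (g - h) (sub_ne_zero.2 hgh)]

/-- «… parity check matrix `H` whose row weight is `k+1`»: diagonal Gram entries of `H = [C | 𝟙]`.
[cite: MacKayMitchisonMcFadden2004, §4.6 Construction U (arXiv:quant-ph/0304161 chunk p0014 L27–29)] -/
theorem unicycleMatrix_mul_transpose_apply_self [Semiring R] (D : Finset G) (g : G) :
    (unicycleMatrix D * (unicycleMatrix D)ᵀ : Matrix G G R) g g = D.card + 1 := by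
  rw [unicycleMatrix_mul_transpose_apply, sub_self,
    Finset.filter_true_of_mem fun a ha => by rwa [zero_add]]

/-- **MMM Construction U is dual-containing:** for a perfect difference set `D` of odd size `k` (so that the
row weight `k + 1` is even — `k = q + 1` with `q = 8, 16, 32, 64` for `M̃ = 73, 273, 1057, 4161`), the
unicycle matrix satisfies `H Hᵀ = 0` in characteristic two («Thus we have defined a dual-containing
`(N+1, K+1)` code»).
[cite: MacKayMitchisonMcFadden2004, §4.6 Construction U (arXiv:quant-ph/0304161 chunk p0014 L19–30)] -/
theorem MacKayMitchisonMcFadden2004_constructionU [Semiring R] (h2 : (2 : R) = 0)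
    {D : Finset G} (hD : IsDifferenceSet D 1) (hodd : Odd D.card) :
    (unicycleMatrix D * (unicycleMatrix D)ᵀ : Matrix G G R) = 0 := by
  ext g h
  rw [Matrix.zero_apply]
  by_cases hgh : g = h
  · subst hgh
    rw [unicycleMatrix_mul_transpose_apply_self, ← Nat.cast_add_one]
    exact natCast_eq_zero_of_even h2 hodd.add_one
  · rw [unicycleMatrix_mul_transpose_apply_of_ne hD hgh, Nat.cast_one, one_add_one_eq_two, h2]

/-! #### The unicycle CSS code over `𝔽₂` and the printed example `M̃ = 73` -/

/-- **MacKay's unicycle code**: the CSS code with `H_X = H_Z = H = [C | 𝟙]` on `M̃ + 1` qubits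
(qubit set `G ⊕ Unit`), for a perfect difference set `D ⊂ G` of odd size.
[cite: MacKayMitchisonMcFadden2004, §2.4.1 and §4.6 Construction U (arXiv:quant-ph/0304161 chunks p0008 L1–7, p0014 L19–30)] -/
def unicycleCode {D : Finset G} (hD : IsDifferenceSet D 1) (hodd : Odd D.card) : CSSCode G G (G ⊕ Unit) :=
  CSSCode.ofMatrices (unicycleMatrix D) (unicycleMatrix D)
    (MacKayMitchisonMcFadden2004_constructionU rfl hD hodd)

/-- `(unicycleCode hD hodd).HX = H`. [cite: MacKayMitchisonMcFadden2004, §4.6 Construction U (arXiv:quant-ph/0304161 chunk p0014 L19–30)] -/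
@[simp] theorem unicycleCode_HX {D : Finset G} (hD : IsDifferenceSet D 1) (hodd : Odd D.card) :
    (unicycleCode hD hodd).HX = unicycleMatrix D := rfl

/-- `(unicycleCode hD hodd).HZ = H` (the same matrix: dual-containing). [cite: MacKayMitchisonMcFadden2004, §4.6 Construction U (arXiv:quant-ph/0304161 chunk p0014 L19–30)] -/
@[simp] theorem unicycleCode_HZ {D : Finset G} (hD : IsDifferenceSet D 1) (hodd : Odd D.card) :
    (unicycleCode hD hodd).HZ = unicycleMatrix D := rfl

/-- «Another disappointing property is that the code has codewords of weight equal to the row-weight»: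
every row of `H` is a codeword of `𝒞(H) = ker H` (dual-containing), of weight `k + 1`.
[cite: MacKayMitchisonMcFadden2004, §4.6 Construction U (arXiv:quant-ph/0304161 chunk p0014 L45–47)] -/
theorem unicycle_row_mem_ker {D : Finset G} (hD : IsDifferenceSet D 1) (hodd : Odd D.card) (g : G) :
    (unicycleMatrix D : Matrix G (G ⊕ Unit) (ZMod 2)) *ᵥ (unicycleMatrix D g) = 0 := by
  have h0 := MacKayMitchisonMcFadden2004_constructionU (R := ZMod 2) rfl hD hodd
  funext r
  have h := congr_fun (congr_fun h0 r) g
  simp only [mul_apply, transpose_apply, Matrix.zero_apply] at h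
  simpa [mulVec, dotProduct] using h

/-- The row weight of `H = [C | 𝟙]` is `k + 1` (over `𝔽₂`: the Hamming weight of a row).
[cite: MacKayMitchisonMcFadden2004, §4.6 Construction U (arXiv:quant-ph/0304161 chunk p0014 L27–29)] -/
theorem hammingNorm_unicycleMatrix_row (D : Finset G) (g : G) :
    hammingNorm (unicycleMatrix (R := ZMod 2) D g) = D.card + 1 := by
  have h1 : ∀ x : G, (if unicycleMatrix (R := ZMod 2) D g (Sum.inl x) ≠ 0 then 1 else 0 : ℕ) =
      if x - g ∈ D then 1 else 0 := by
    intro x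
    rw [unicycleMatrix_apply_inl]
    by_cases h : x - g ∈ D <;> simp [h]
  have h2 : ∀ u : Unit, (if unicycleMatrix (R := ZMod 2) D g (Sum.inr u) ≠ 0 then 1 else 0 : ℕ) = 1 := by
    intro u
    rw [unicycleMatrix_apply_inr]
    simp
  simp only [hammingNorm, Finset.card_filter]
  rw [Fintype.sum_sum_type, Finset.sum_congr rfl fun x _ => h1 x, Finset.sum_congr rfl fun u _ => h2 u,
    Finset.sum_boole, card_filter_sub_mem, Finset.sum_const, Finset.card_univ, Fintype.card_unit]
  simp

/-- The column weights of `H = [C | 𝟙]` on the cyclic block are all `k` …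
[cite: MacKayMitchisonMcFadden2004, §4.6 Construction U (arXiv:quant-ph/0304161 chunk p0014 L29–30)] -/
theorem card_column_inl (D : Finset G) (x : G) :
    (univ.filter fun g : G => unicycleMatrix (R := ZMod 2) D g (Sum.inl x) ≠ 0).card = D.card := by
  refine Finset.card_bij' (fun g _ => x - g) (fun a _ => x - a) ?_ ?_ ?_ ?_
  · intro g hg
    simp only [mem_filter, mem_univ, true_and, unicycleMatrix_apply_inl] at hg
    by_contra h
    exact hg (if_neg h)
  · intro a ha
    simp only [mem_filter, mem_univ, true_and, unicycleMatrix_apply_inl, sub_sub_cancel, if_pos ha]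
    exact one_ne_zero
  · intro g _; exact sub_sub_cancel x g
  · intro a _; exact sub_sub_cancel x a

/-- … «except for one column with enormous weight `M̃`» (the all-ones column).
[cite: MacKayMitchisonMcFadden2004, §4.6 Construction U (arXiv:quant-ph/0304161 chunk p0014 L29–30)] -/
theorem card_column_inr (D : Finset G) :
    (univ.filter fun g : G => unicycleMatrix (R := ZMod 2) D g (Sum.inr ()) ≠ 0).card = Fintype.card G := by
  simp

/-- **The printed example:** «a perfect difference set for the group of size `M̃ = 73` is
`{2,8,15,19,20,34,42,44,72}`» — every nonzero residue mod `73` is a difference of two of its elements in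
exactly one way (kernel `decide`). [cite: MacKayMitchisonMcFadden2004, §4.6 Construction U (arXiv:quant-ph/0304161 chunk p0014 L4–5)] -/
theorem isDifferenceSet_pds73 :
    IsDifferenceSet ({2, 8, 15, 19, 20, 34, 42, 44, 72} : Finset (ZMod 73)) 1 := by
  unfold IsDifferenceSet
  decide

/-- `|{2,8,15,19,20,34,42,44,72}| = 9` is odd (row weight `10`). [cite: MacKayMitchisonMcFadden2004, §4.6 Construction U (arXiv:quant-ph/0304161 chunk p0014 L27–29)] -/
theorem odd_card_pds73 : Odd ({2, 8, 15, 19, 20, 34, 42, 44, 72} : Finset (ZMod 73)).card :=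
  ⟨4, by decide⟩

/-- The `M̃ = 73` unicycle code: `74` qubits, `73` checks of each kind, of row weight `10` («for example,
`10`, for `M̃ = 73`»). [cite: MacKayMitchisonMcFadden2004, §4.6 Construction U (arXiv:quant-ph/0304161 chunk p0014 L4–5, L27–29)] -/
def unicycleCode73 : CSSCode (ZMod 73) (ZMod 73) (ZMod 73 ⊕ Unit) :=
  unicycleCode isDifferenceSet_pds73 odd_card_pds73

/-- Its rows have weight `10`. [cite: MacKayMitchisonMcFadden2004, §4.6 Construction U (arXiv:quant-ph/0304161 chunk p0014 L27–29)] -/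
theorem hammingNorm_unicycleCode73_row (g : ZMod 73) : hammingNorm (unicycleCode73.HX g) = 10 :=
  (hammingNorm_unicycleMatrix_row _ g).trans (by decide)

/-! ### Construction N: several cyclic matrices side by side -/

section ConstructionN

variable {ι : Type*}

omit [Fintype G] in
/-- **Construction N's parity-check matrix** `H = [C_{D₁} | ⋯ | C_{D_v}]`: «we turn each set into a square
cyclic matrix and put the matrices alongside each other» (blocks indexed by `ι`, columns by `ι × G`).
[cite: MacKayMitchisonMcFadden2004, §4.6 Construction N (arXiv:quant-ph/0304161 chunk p0014 L73–74)] -/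
def multiCyclicMatrix [Zero R] [One R] (D : ι → Finset G) : Matrix G (ι × G) R :=
  of fun g p => if p.2 - g ∈ D p.1 then 1 else 0

omit [Fintype G] in
/-- Entries of `multiCyclicMatrix`. [cite: MacKayMitchisonMcFadden2004, §4.6 Construction N (arXiv:quant-ph/0304161 chunk p0014 L73–74)] -/
theorem multiCyclicMatrix_apply [Zero R] [One R] (D : ι → Finset G) (g : G) (l : ι) (x : G) :
    multiCyclicMatrix (R := R) D g (l, x) = if x - g ∈ D l then 1 else 0 := rfl

variable [Fintype ι]

/-- **Gram entries of `H = [C_{D₁} | ⋯ | C_{D_v}]`:** the overlap of rows `g, h` is the total number of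
occurrences of the difference `g − h` inside the sets `D_l`.
[cite: MacKayMitchisonMcFadden2004, §4.6 Construction N (arXiv:quant-ph/0304161 chunk p0014 L75–76)] -/
theorem multiCyclicMatrix_mul_transpose_apply [Semiring R] (D : ι → Finset G) (g h : G) :
    (multiCyclicMatrix D * (multiCyclicMatrix D)ᵀ : Matrix G G R) g h =
      ∑ l, (((D l).filter fun a => (g - h) + a ∈ D l).card : R) := by
  rw [mul_apply, Fintype.sum_prod_type]
  refine Finset.sum_congr rfl fun l _ => ?_
  rw [← cyclicOf_mul_transpose_apply, mul_apply]
  rfl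

/-- **MMM Construction N is dual-containing:** if every nonzero difference occurs an even number of times
among the sets `D_l` («every difference (modulo `M`) occurs zero times or twice … the overlap between any
pair of rows is even») and the row weight `Σ_l |D_l|` is even, then `H Hᵀ = 0` in characteristic two.
(Construction M is the special case where the `D_l` are derived from one parent difference set.)
[cite: MacKayMitchisonMcFadden2004, §4.6 Construction N (arXiv:quant-ph/0304161 chunk p0014 L50–76) and Construction M (L78–90)] -/
theorem MacKayMitchisonMcFadden2004_constructionN [Semiring R] (h2 : (2 : R) = 0)
    (D : ι → Finset G)
    (hdiff : ∀ δ : G, δ ≠ 0 → Even (∑ l, ((D l).filter fun a => δ + a ∈ D l).card))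
    (hrow : Even (∑ l, (D l).card)) :
    (multiCyclicMatrix D * (multiCyclicMatrix D)ᵀ : Matrix G G R) = 0 := by
  ext g h
  rw [Matrix.zero_apply, multiCyclicMatrix_mul_transpose_apply, ← Nat.cast_sum]
  by_cases hgh : g = h
  · subst hgh
    refine natCast_eq_zero_of_even h2 ?_
    have hl : ∀ l, ((D l).filter fun a => g - g + a ∈ D l) = D l := fun l =>
      Finset.filter_true_of_mem fun a ha => by rwa [sub_self, zero_add]
    simp only [hl]
    exact hrow
  · exact natCast_eq_zero_of_even h2 (hdiff (g - h) (sub_ne_zero.2 hgh))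

/-- **Construction N's CSS code** over `𝔽₂`: `H_X = H_Z = H = [C_{D₁} | ⋯ | C_{D_v}]` under the printed
difference condition. [cite: MacKayMitchisonMcFadden2004, §2.4.1 and §4.6 Construction N (arXiv:quant-ph/0304161 chunks p0008 L1–7, p0014 L50–76)] -/
def multiCyclicCode (D : ι → Finset G)
    (hdiff : ∀ δ : G, δ ≠ 0 → Even (∑ l, ((D l).filter fun a => δ + a ∈ D l).card))
    (hrow : Even (∑ l, (D l).card)) : CSSCode G G (ι × G) :=
  CSSCode.ofMatrices (multiCyclicMatrix D) (multiCyclicMatrix D)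
    (MacKayMitchisonMcFadden2004_constructionN rfl D hdiff hrow)

omit [Fintype ι] in
/-- The cyclic matrices of two subsets commute (they are circulants).
[cite: MacKayMitchisonMcFadden2004, §4.6 (arXiv:quant-ph/0304161 chunk p0014 L94–97)] -/
theorem cyclicOf_mul_comm [CommRing R] (D E : Finset G) :
    (cyclicOf D * cyclicOf E : Matrix G G R) = cyclicOf E * cyclicOf D := by
  rw [cyclicOf_eq_circulant, cyclicOf_eq_circulant, circulant_mul_comm]

variable [DecidableEq ι]

omit [Fintype G] [Fintype ι] in
/-- The caveat word `(g, f)`: on block `l₁` the column `0` of `C_{D_{l₂}}`, on block `l₂` the column `0` of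
`C_{D_{l₁}}`, zero elsewhere. [cite: MacKayMitchisonMcFadden2004, §4.6 (arXiv:quant-ph/0304161 chunk p0014 L94–97)] -/
def pairWord [Zero R] [One R] (D : ι → Finset G) (l₁ l₂ : ι) : ι × G → R :=
  fun p => if p.1 = l₁ then cyclicOf (D l₂) p.2 0 else if p.1 = l₂ then cyclicOf (D l₁) p.2 0 else 0

/-- **The printed caveat:** «for any pair of square cyclic matrices associated with vectors `f` and `g` …
the vector `(g, f)` is a … codeword» — `H · pairWord = C_{l₁} C_{l₂} e₀ + C_{l₂} C_{l₁} e₀ = 0` in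
characteristic two, since cyclic matrices commute.
[cite: MacKayMitchisonMcFadden2004, §4.6 (arXiv:quant-ph/0304161 chunk p0014 L92–97)] -/
theorem multiCyclicMatrix_mulVec_pairWord [CommRing R] (h2 : (2 : R) = 0) (D : ι → Finset G)
    {l₁ l₂ : ι} (hl : l₁ ≠ l₂) :
    (multiCyclicMatrix D : Matrix G (ι × G) R) *ᵥ pairWord D l₁ l₂ = 0 := by
  funext g
  rw [mulVec, dotProduct, Fintype.sum_prod_type, Pi.zero_apply]
  have hsplit : ∀ l, ∑ x, multiCyclicMatrix (R := R) D g (l, x) * pairWord D l₁ l₂ (l, x) =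
      if l = l₁ then (cyclicOf (D l₁) * cyclicOf (D l₂) : Matrix G G R) g 0
      else if l = l₂ then (cyclicOf (D l₂) * cyclicOf (D l₁) : Matrix G G R) g 0 else 0 := by
    intro l
    by_cases h1 : l = l₁
    · subst h1
      simp only [multiCyclicMatrix_apply, pairWord, if_true, mul_apply, cyclicOf_apply]
    · by_cases h2' : l = l₂
      · subst h2'
        simp only [multiCyclicMatrix_apply, pairWord, if_neg h1, if_true, mul_apply, cyclicOf_apply]
      · simp only [pairWord, if_neg h1, if_neg h2', mul_zero, Finset.sum_const_zero]
  simp only [hsplit]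
  rw [Fintype.sum_eq_add l₁ l₂ hl fun l hl' => by rw [if_neg hl'.1, if_neg hl'.2], if_pos rfl,
    if_neg (Ne.symm hl), if_pos rfl, cyclicOf_mul_comm (D l₂) (D l₁), ← two_mul, h2, zero_mul]

end ConstructionN

end DifferenceSetCSS

end Literature.InformationTheory.QuantumCodes
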